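import Summits.AnomalousDissipation.AnomalousDissipation.Theorems.SawtoothPulseCascadeK1LocalisedCascadeZoneReadmit

/-!
# K1loc, line `Spectral` / SeqCone — helper: THE SLOT SWITCH OF THE ENERGY LEDGER (two families + carrier + zone re-admission)

Helper file of the prover lane on the crux `K1LocalisedCascade` (stmt-AnomalousDissipation-19491), route
`SawtoothPulseCascade`, registered stub `stub_highModeConcentration` (memo v7 §2, "S-C′ energy ledger", step (iv)).

At a half-slot boundary `t = t_{s+1}` the per-family steps (`…FamilyStep`) deliver the symbol energies of the two
flat-strip pieces `X⁺·v`, `X⁻·v` (`v = w(t_{s+1})`, cut-offs of the OLD sheared coordinate), while the next slot tracks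
`X̂'·v` with the carrier cut-off `X̂'` of the NEW sheared coordinate.  The switch
  `X̂'·v = X̂'·(X⁺+X⁻)·v + X̂'·(1 − X⁺ − X⁻)·v`
is book-kept in ENERGY (no restart of the equation, no amplitude junk):
* `tsum_symbol_sq_two_family_carrier_le` — inserting the carrier and adding the two DISJOINT families:
  `Σ m²|𝓕((X⁺+X⁻)X̂'v)|² ≤ Σ_σ (√Σ m²|𝓕(X^σ v)|² + (Σ ω|𝓕X̂'|)·‖X^σ v‖)² + 2(Σ ω₂|𝓕X⁺|)·∫|X̂'v|²`
  (`…SmoothLeakage.sqrt_tsum_symbol_sq_mul_le`, `…SpectralCommutator.norm_tsum_symbol_sq_cross_le`,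
  `…SlotExpansionTwoBranch.tsum_symbol_sq_add_le_of_bounds`);
* `tsum_symbol_sq_switch_le` — composed with the zone re-admission `…ZoneReadmit.tsum_symbol_sq_le_readmit` and the
  carriers `integral_norm_sq_one_sub_mul_le` / `integral_norm_sq_overlap_le`: for a real total cut-off `X = X⁺+X⁻ ∈ [0,1]`
  and `‖v‖ ≤ B` (maximum principle),
  `Σ m²|𝓕(X̂'v)|² ≤ [two-family bound] + M²B²·vol{X ≠ 1} + 2((Σ ω₂|𝓕X|)∫|X̂'v|² + M²‖X̂'v‖·(B/4)·√vol{0<X<1})`.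
The zone `{X ≠ 1}` enters with its MEASURE (times `B²`), the transition layer `{0 < X < 1}` with the square root of its
measure times `‖X̂'v‖`, and all commutator constants are `ℓ¹`-moments of cut-off spectra against symbol moduli.

WHAT THIS IS NOT: no statement about the cascade or the stub itself; the slot inputs `√Σ m²|𝓕(X^σ v)|²` are what
`…FamilyStep.sqrt_tsum_symbol_sq_family_step_H/_V` bound.
[cite: Grafakos2014, Prop. 3.1.2 (5) (coefficients of products) and Prop. 3.2.7 (3) (Parseval)] [problem: turb]
-/

-- `Summit.<Summit>.<Problem>`: single-conjunct summit, the duplicate namespace segment is deliberate.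
set_option linter.dupNamespace false

noncomputable section

namespace Summit.AnomalousDissipation.AnomalousDissipation.Theorems.SawtoothPulseCascade.K1Slot

open MeasureTheory Set Filter Topology UnitAddTorus Complex
open scoped ComplexConjugate
open Literature.Analysis Literature.Analysis.FunctionSpaces Literature.Analysis.FluidPDE
open Literature.Analysis.FunctionSpaces.Torus
open Summit.AnomalousDissipation.AnomalousDissipation.Theorems.SawtoothPulseCascade.SpectralLeakage

variable {d : Type*} [Fintype d] [DecidableEq d]

/-! ## §1 Two disjoint families behind a common carrier -/

/-- **Two disjoint families behind a carrier cut-off.**  Let `v, X⁺, X⁻, X̂' : T^d → ℂ` be smooth, `‖X̂'‖ ≤ 1`,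
`‖X⁻‖ ≤ 1`, `conj(X⁺)·X⁻ = 0` (disjoint families), `m` a real symbol with `|m| ≤ M`, modulus `ω` of `m`
(`|m k − m (k−n)| ≤ ω n`) and `ω₂` of `m²`.  Then
`Σ m²|𝓕((X⁺+X⁻)·X̂'·v)|² ≤ Σ_σ (√Σ m²|𝓕(X^σ v)|² + (Σₙ ω n ‖𝓕X̂' n‖)·√∫‖X^σ v‖²)² + 2·(Σₙ ω₂ n ‖𝓕X⁺ n‖)·∫‖X̂' v‖²`.
[cite: Grafakos2014, Prop. 3.1.2 (5) and Prop. 3.2.7 (3)] -/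
theorem tsum_symbol_sq_two_family_carrier_le {v Xp Xm Xc : UnitAddTorus d → ℂ} (hv : IsSmooth v)
    (hXp : IsSmooth Xp) (hXm : IsSmooth Xm) (hXc : IsSmooth Xc) (hXc1 : ∀ x, ‖Xc x‖ ≤ 1) (hXm1 : ∀ x, ‖Xm x‖ ≤ 1)
    (hdis : ∀ x, conj (Xp x) * Xm x = 0)
    {m : (d → ℤ) → ℝ} {M : ℝ} (hmM : ∀ k, |m k| ≤ M)
    {ω : (d → ℤ) → ℝ} (hω0 : ∀ n, 0 ≤ ω n) (hω : ∀ k n, |m k - m (k - n)| ≤ ω n)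
    (hωs : Summable fun n => ω n * ‖mFourierCoeff Xc n‖)
    {ω₂ : (d → ℤ) → ℝ} (hω20 : ∀ n, 0 ≤ ω₂ n) (hω2 : ∀ k n, |m k ^ 2 - m (k - n) ^ 2| ≤ ω₂ n)
    (hω2s : Summable fun n => ω₂ n * ‖mFourierCoeff Xp n‖) :
    ∑' k, m k ^ 2 * ‖mFourierCoeff (fun x => (Xp x + Xm x) * (Xc x * v x)) k‖ ^ 2 ≤
      (Real.sqrt (∑' k, m k ^ 2 * ‖mFourierCoeff (fun x => Xp x * v x) k‖ ^ 2) +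
          (∑' n, ω n * ‖mFourierCoeff Xc n‖) * Real.sqrt (∫ x, ‖Xp x * v x‖ ^ 2)) ^ 2 +
      (Real.sqrt (∑' k, m k ^ 2 * ‖mFourierCoeff (fun x => Xm x * v x) k‖ ^ 2) +
          (∑' n, ω n * ‖mFourierCoeff Xc n‖) * Real.sqrt (∫ x, ‖Xm x * v x‖ ^ 2)) ^ 2 +
      2 * ((∑' n, ω₂ n * ‖mFourierCoeff Xp n‖) * ∫ x, ‖Xc x * v x‖ ^ 2) := by
  -- the carrier-cut function `W = X̂' v` and the two pieces `P = X⁺ W = X̂' (X⁺ v)`, `Q = X⁻ W`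
  have hW : IsSmooth (fun x => Xc x * v x) := hXc.mul hv
  have hPf : IsSmooth (fun x => Xp x * v x) := hXp.mul hv
  have hQf : IsSmooth (fun x => Xm x * v x) := hXm.mul hv
  -- inserting the carrier: `‖m(D)(X̂'·(X^σ v))‖ ≤ ‖m(D)(X^σ v)‖ + (Σω|𝓕X̂'|)‖X^σ v‖`
  have hinsP := sqrt_tsum_symbol_sq_mul_le (F := fun x => Xp x * v x) (Θ := Xc) hPf.continuous
    hPf.rapidDecay_mFourierCoeff.summable_norm hXc.continuous hXc.rapidDecay_mFourierCoeff.summable_norm hXc1 hmM hω0 hω hωs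
  have hinsQ := sqrt_tsum_symbol_sq_mul_le (F := fun x => Xm x * v x) (Θ := Xc) hQf.continuous
    hQf.rapidDecay_mFourierCoeff.summable_norm hXc.continuous hXc.rapidDecay_mFourierCoeff.summable_norm hXc1 hmM hω0 hω hωs
  -- the disjoint cross term with `G = W`
  have hcross := norm_tsum_symbol_sq_cross_le (G := fun x => Xc x * v x) (Θ₁ := Xp) (Θ₂ := Xm) hW.continuous
    hW.rapidDecay_mFourierCoeff.summable_norm hXp.continuous hXp.rapidDecay_mFourierCoeff.summable_norm hXm.continuous hXm1
    hdis hmM hω20 hω2 hω2s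
  -- rewrite `X^σ (X̂' v) = X̂' (X^σ v)`
  have hPW : (fun x => Xp x * (Xc x * v x)) = fun x => Xc x * (Xp x * v x) := by funext x; ring
  have hQW : (fun x => Xm x * (Xc x * v x)) = fun x => Xc x * (Xm x * v x) := by funext x; ring
  have hinsP' : Real.sqrt (∑' k, m k ^ 2 * ‖mFourierCoeff (fun x => Xp x * (Xc x * v x)) k‖ ^ 2) ≤
      Real.sqrt (∑' k, m k ^ 2 * ‖mFourierCoeff (fun x => Xp x * v x) k‖ ^ 2) +
        (∑' n, ω n * ‖mFourierCoeff Xc n‖) * Real.sqrt (∫ x, ‖Xp x * v x‖ ^ 2) := by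
    rw [hPW]; exact hinsP
  have hinsQ' : Real.sqrt (∑' k, m k ^ 2 * ‖mFourierCoeff (fun x => Xm x * (Xc x * v x)) k‖ ^ 2) ≤
      Real.sqrt (∑' k, m k ^ 2 * ‖mFourierCoeff (fun x => Xm x * v x) k‖ ^ 2) +
        (∑' n, ω n * ‖mFourierCoeff Xc n‖) * Real.sqrt (∫ x, ‖Xm x * v x‖ ^ 2) := by
    rw [hQW]; exact hinsQ
  have hadd := tsum_symbol_sq_add_le_of_bounds (P := fun x => Xp x * (Xc x * v x)) (Q := fun x => Xm x * (Xc x * v x))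
    (hXp.continuous.mul hW.continuous) (hXm.continuous.mul hW.continuous) hmM hinsP' hinsQ' hcross
  have hsum : (fun x => Xp x * (Xc x * v x) + Xm x * (Xc x * v x)) = fun x => (Xp x + Xm x) * (Xc x * v x) := by
    funext x; ring
  rw [hsum] at hadd
  exact hadd

/-! ## §2 The full switch: two families + carrier + zone re-admission -/

/-- **The slot switch of the energy ledger.**  Data: smooth `v` with `‖v‖ ≤ B` (the solution at the slot boundary, after
the maximum principle), the two smooth flat-strip cut-offs `X⁺, X⁻` of the old sheared coordinate with `conj(X⁺)X⁻ = 0`,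
`‖X⁻‖ ≤ 1`, and REAL total `X⁺ + X⁻ = θ ∈ [0,1]`; the smooth carrier `X̂'` of the new slot, `‖X̂'‖ ≤ 1`; a real symbol
`|m| ≤ M` with moduli `ω` (of `m`) and `ω₂` (of `m²`).  Then
`Σ m²|𝓕(X̂'v)|² ≤ Σ_σ(√Σ m²|𝓕(X^σ v)|² + (Σ ω|𝓕X̂'|)‖X^σ v‖)² + 2(Σ ω₂|𝓕X⁺|)∫|X̂'v|²`
`  + M²B²·vol{θ ≠ 1} + 2((Σ ω₂|𝓕(X⁺+X⁻)|)∫|X̂'v|² + M²√(∫|X̂'v|²)·(B/4)·√vol{θ ≠ 0 ∧ θ ≠ 1})`: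
the zone `{θ ≠ 1}` is charged with its measure (ENERGY accounting), the transition layer with the root of its measure.
[cite: Grafakos2014, Prop. 3.1.2 (5) and Prop. 3.2.7 (3)] -/
theorem tsum_symbol_sq_switch_le {v Xp Xm Xc : UnitAddTorus d → ℂ} (hv : IsSmooth v)
    (hXp : IsSmooth Xp) (hXm : IsSmooth Xm) (hXc : IsSmooth Xc) (hXc1 : ∀ x, ‖Xc x‖ ≤ 1) (hXm1 : ∀ x, ‖Xm x‖ ≤ 1)
    (hdis : ∀ x, conj (Xp x) * Xm x = 0) {θ : UnitAddTorus d → ℝ} (hθ : Continuous θ) (hθ0 : ∀ x, 0 ≤ θ x)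
    (hθ1 : ∀ x, θ x ≤ 1) (hXθ : ∀ x, Xp x + Xm x = θ x) {B : ℝ} (hvB : ∀ x, ‖v x‖ ≤ B)
    {m : (d → ℤ) → ℝ} {M : ℝ} (hmM : ∀ k, |m k| ≤ M)
    {ω : (d → ℤ) → ℝ} (hω0 : ∀ n, 0 ≤ ω n) (hω : ∀ k n, |m k - m (k - n)| ≤ ω n)
    (hωs : Summable fun n => ω n * ‖mFourierCoeff Xc n‖)
    {ω₂ : (d → ℤ) → ℝ} (hω20 : ∀ n, 0 ≤ ω₂ n) (hω2 : ∀ k n, |m k ^ 2 - m (k - n) ^ 2| ≤ ω₂ n)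
    (hω2p : Summable fun n => ω₂ n * ‖mFourierCoeff Xp n‖)
    (hω2s : Summable fun n => ω₂ n * ‖mFourierCoeff (fun x => Xp x + Xm x) n‖) :
    ∑' k, m k ^ 2 * ‖mFourierCoeff (fun x => Xc x * v x) k‖ ^ 2 ≤
      (Real.sqrt (∑' k, m k ^ 2 * ‖mFourierCoeff (fun x => Xp x * v x) k‖ ^ 2) +
          (∑' n, ω n * ‖mFourierCoeff Xc n‖) * Real.sqrt (∫ x, ‖Xp x * v x‖ ^ 2)) ^ 2 +
      (Real.sqrt (∑' k, m k ^ 2 * ‖mFourierCoeff (fun x => Xm x * v x) k‖ ^ 2) +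
          (∑' n, ω n * ‖mFourierCoeff Xc n‖) * Real.sqrt (∫ x, ‖Xm x * v x‖ ^ 2)) ^ 2 +
      2 * ((∑' n, ω₂ n * ‖mFourierCoeff Xp n‖) * ∫ x, ‖Xc x * v x‖ ^ 2) +
      M ^ 2 * (B ^ 2 * volume.real {x | θ x ≠ 1}) +
      2 * ((∑' n, ω₂ n * ‖mFourierCoeff (fun x => Xp x + Xm x) n‖) * (∫ x, ‖Xc x * v x‖ ^ 2) +
        M ^ 2 * Real.sqrt (∫ x, ‖Xc x * v x‖ ^ 2) *
          ((B / 4) * Real.sqrt (volume.real {x | θ x ≠ 0 ∧ θ x ≠ 1}))) := by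
  have hM0 : 0 ≤ M := (abs_nonneg _).trans (hmM 0)
  have hB0 : 0 ≤ B := (norm_nonneg _).trans (hvB 0)
  have hW : IsSmooth (fun x => Xc x * v x) := hXc.mul hv
  have hX : IsSmooth (fun x => Xp x + Xm x) := hXp.add hXm
  have hWB : ∀ x, ‖Xc x * v x‖ ≤ B := fun x => by
    rw [norm_mul]
    calc ‖Xc x‖ * ‖v x‖ ≤ 1 * B := mul_le_mul (hXc1 x) (hvB x) (norm_nonneg _) zero_le_one
      _ = B := one_mul B
  have hXθ' : (fun x => Xp x + Xm x) = fun x => ((θ x : ℝ) : ℂ) := funext hXθ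
  -- `‖1 − θ‖ ≤ 1`
  have h1θ : ∀ x, ‖(1 : ℂ) - (Xp x + Xm x)‖ ≤ 1 := fun x => by
    rw [hXθ x, show ((1 : ℂ) - θ x) = ((1 - θ x : ℝ) : ℂ) by push_cast; ring, Complex.norm_real, Real.norm_eq_abs,
      abs_le]
    constructor <;> linarith [hθ0 x, hθ1 x]
  -- (a) re-admission
  have hre := tsum_symbol_sq_le_readmit (W := fun x => Xc x * v x) (Θ := fun x => Xp x + Xm x) hW.continuous
    hW.rapidDecay_mFourierCoeff.summable_norm hX.continuous hX.rapidDecay_mFourierCoeff.summable_norm h1θ hmM hω20 hω2 hω2s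
  -- (b) two families behind the carrier
  have htwo := tsum_symbol_sq_two_family_carrier_le hv hXp hXm hXc hXc1 hXm1 hdis hmM hω0 hω hωs hω20 hω2 hω2p
  -- (c) the carriers
  have hzone : ∫ x, ‖(1 - (Xp x + Xm x)) * (Xc x * v x)‖ ^ 2 ≤ B ^ 2 * volume.real {x | θ x ≠ 1} := by
    have h := integral_norm_sq_one_sub_mul_le (W := fun x => Xc x * v x) hW.continuous hθ
      (fun x => by rw [abs_le]; constructor <;> linarith [hθ0 x, hθ1 x]) hWB
    refine le_trans (le_of_eq (integral_congr_ae (ae_of_all _ fun x => ?_))) h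
    simp only [hXθ x]
  have hlayer : ∫ x, ‖(Xp x + Xm x) * (1 - (Xp x + Xm x)) * (Xc x * v x)‖ ^ 2 ≤
      (B / 4) ^ 2 * volume.real {x | θ x ≠ 0 ∧ θ x ≠ 1} := by
    have h := integral_norm_sq_overlap_le (W := fun x => Xc x * v x) hW.continuous hθ hθ0 hθ1 hWB
    refine le_trans (le_of_eq (integral_congr_ae (ae_of_all _ fun x => ?_))) h
    simp only [hXθ x]
  have hlayer' : Real.sqrt (∫ x, ‖(Xp x + Xm x) * (1 - (Xp x + Xm x)) * (Xc x * v x)‖ ^ 2) ≤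
      (B / 4) * Real.sqrt (volume.real {x | θ x ≠ 0 ∧ θ x ≠ 1}) := by
    calc Real.sqrt (∫ x, ‖(Xp x + Xm x) * (1 - (Xp x + Xm x)) * (Xc x * v x)‖ ^ 2)
        ≤ Real.sqrt ((B / 4) ^ 2 * volume.real {x | θ x ≠ 0 ∧ θ x ≠ 1}) := Real.sqrt_le_sqrt hlayer
      _ = (B / 4) * Real.sqrt (volume.real {x | θ x ≠ 0 ∧ θ x ≠ 1}) := by
          rw [Real.sqrt_mul (sq_nonneg _), Real.sqrt_sq (by positivity)]
  -- assemble
  have hω2s_nn : 0 ≤ ∑' n, ω₂ n * ‖mFourierCoeff (fun x => Xp x + Xm x) n‖ :=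
    tsum_nonneg fun n => mul_nonneg (hω20 n) (norm_nonneg _)
  have hWint0 : 0 ≤ ∫ x, ‖Xc x * v x‖ ^ 2 := integral_nonneg fun x => by positivity
  have hM2 : 0 ≤ M ^ 2 := sq_nonneg _
  have h3 : M ^ 2 * ∫ x, ‖(1 - (Xp x + Xm x)) * (Xc x * v x)‖ ^ 2 ≤ M ^ 2 * (B ^ 2 * volume.real {x | θ x ≠ 1}) :=
    mul_le_mul_of_nonneg_left hzone hM2
  have h4 : M ^ 2 * Real.sqrt (∫ x, ‖Xc x * v x‖ ^ 2) *
        Real.sqrt (∫ x, ‖(Xp x + Xm x) * (1 - (Xp x + Xm x)) * (Xc x * v x)‖ ^ 2) ≤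
      M ^ 2 * Real.sqrt (∫ x, ‖Xc x * v x‖ ^ 2) * ((B / 4) * Real.sqrt (volume.real {x | θ x ≠ 0 ∧ θ x ≠ 1})) :=
    mul_le_mul_of_nonneg_left hlayer' (mul_nonneg hM2 (Real.sqrt_nonneg _))
  linarith [hre, htwo, h3, h4]

end Summit.AnomalousDissipation.AnomalousDissipation.Theorems.SawtoothPulseCascade.K1Slot
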